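import Literature.NumberTheory.Rogawski1990.UnitFundamentalLemmaInertLevi          -- ★ p840628∕p840641 (F0P3b-p01 (g6)): `isConj_of_isLocalStablyConjH_of_levi`, `isUnit_vecCons_sub_of_levi`; brings ★ `FinExplicitTransferFactorLeviStratum`, ★ `UnitFundamentalLemmaInertResiduallyRegular`
import Literature.NumberTheory.Automorphic.LocalUnitaryGroupSimilitude                -- ★ `corresponds_cmDatumLocalCongr`
import HarnessLib

/-!
# (4.3.1) on the LEVI (split-torus) stratum has ONE TERM on each side — general test functions: `Φ_H(⟦γ_H⟧, f^H) = Δ_v(γ_H, γ₀) · Φ_G(⟦γ₀⟧, f)`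
(Rogawski (1990), §4.3 (4.3.1) p. 43; §4.9 pp. 54–56 (Prop. 4.9.1, Lemma 4.9.2: on `M` the stable class and the `κ`-class are single conjugacy classes);
§3.5 Prop. 3.5.2 p. 29; Kottwitz (1986) §7)

Topic `NumberTheory/Rogawski1990`; namespace `Literature.NumberTheory.Rogawski1990`.  THEOREMS ONLY (no definition, no instance, no notation, no named fact,
no `sorry`).  Cell `pub/hodgecm-mathlib`, line «CMCharIdentityTest» (F0P3b), desk F0P3b-plan (g12) PLAN v14 §10 brick **S3 «ONE-TERM TRANSFER ON THE LEVI
STRATUM»**, FILE S3-A (the sign-AGNOSTIC half); seat F0P3b-p01 (g7).  HONEST LABEL: HC_CM is proved only modulo the 2 remaining named inputs (hLiu418, h413)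
until rung 0 closes; this file proves no letter.

THE POINT.  ★ `UnitFundamentalLemmaInertResiduallyRegular` §1 proved the one-term collapse of both sides of (4.3.1) for the UNITS `1_{K_H}`, `1_{K′}` (uniqueness
binders relative to `K`), and ★ g6 `UnitFundamentalLemmaInertLevi` supplied the Levi-stratum uniqueness binders.  Lemma 4.9.2 needs the same collapse for
ARBITRARY test functions, with GLOBAL uniqueness (no `K`):
* §1 (generic, any groups `A`, `B`, any ★ `TransferFactorData`, any families, any `f`):
  **`finsum_delta_mul_classOrbitalIntegral_eq_of_unique`** — if every `k` with `R a k` is conjugate to `b₀`, `∑ᶠ c, Δ(a, out c) · Φ(c, f) = Δ(a, b₀) · Φ(⟦b₀⟧, f)`;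
  **`stableOrbitalIntegralRel_eq_classOrbitalIntegral_of_unique`** — if `st` contains conjugacy and every `k` with `st a k` is conjugate to `a`, `Φ^st(a, f) = Φ(⟦a⟧, f)`.
* §2 (CM, `H_v = U(Φ₂)(L⁺_v) × U(Φ₁)(L⁺_v) → G′_v = U(H′)(L⁺_v)`, any finite `v`, any ★ `LocalTransferFactor`, any families):
  **`isLocalNormPair_cmDatumLocalCongr_endoEmbLocal`** — the frame of the (N-492) stub supplies a norm pair: `ι_v(γ_H) ↔ e(ι_v γ_H)` for `e := cmDatumLocalCongr L v T ha h`
  (★ `corresponds_cmDatumLocalCongr`);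
  **`classOrbitalIntegral_eq_delta_mul_classOrbitalIntegral_of_levi`** — for `γ_H = (diag(d′₀, d′₁), u)` on the LEVI STRATUM (`d′₀⁻¹u − 1`, `d′₀⁻¹d′₁ − 1`,
  `u − d′₁` units), `G`-regular, any norm pair `γ₀`, and `(f^H, f)` an ★ `IsLocalDeltaTransfer` pair:
  `classOrbitalIntegral mH fH ⟦γ_H⟧ = T.Δ γ_H γ₀ * classOrbitalIntegral mG f ⟦γ₀⟧` — `huniqH` ★ `isConj_of_isLocalStablyConjH_of_levi`, `huniqG` ★
  `isConj_of_isLocalNormPair_of_isLocalNormPair_of_levi` (two norm pairs of a Levi `γ_H` are conjugate: `𝔇(T∕F) = 1` for the split torus), `hrefl` ★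
  `isLocalStablyConjH_of_isConj_and_conj`; and the frame instance **`…_of_levi_cmDatumLocalCongr`** at `γ₀ := e(ι_v γ_H)`.
This is S3 (iii) of PLAN v14 §10, SIGN-AGNOSTIC: the VALUE `T.Δ γ_H γ₀` for Rogawski's `Δ‴_v` on the stratum (`τ_v · D_v · κ_v` with `κ_v = ω_w(a)`, see the census
`CENSUS-S3-LeviOneTerm-KappaSign`) is FILE S3-B.  Print: «If `γ ∈ M` … the `κ`-orbital integral is the ordinary orbital integral» [§4.9 p. 55]; «`{γ}_{st} ∩ M`
is a single conjugacy class» (Prop. 3.5.2).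

## References
* [Rogawski1990] J. D. Rogawski, *Automorphic Representations of Unitary Groups in Three Variables*, Ann. of Math. Stud. 123 (1990): §4.3 (4.3.1) p. 43; §4.9
  pp. 54–56; §3.5 Prop. 3.5.2 p. 29; §4.1 (4.1.1) p. 39.
* [Kottwitz1986] R. E. Kottwitz, *Base change for unit elements of Hecke algebras*, Compositio Math. 60 (1986): §7.
-/

set_option autoImplicit false

noncomputable section

open MeasureTheory Measure Set NumberField IsDedekindDomain Matrix
open Literature.NumberTheory.Automorphic Literature.NumberTheory.Automorphic.UnitaryGroup
open Literature.NumberTheory.GaloisRepresentations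
open scoped NNReal Matrix MatrixGroups

namespace Literature.NumberTheory.Rogawski1990

/-! ## §1 Generic one-term collapse of (4.3.1), arbitrary test functions -/

section Generic

variable {A B : Type*} [Group A] [Group B]

/-- **The `G`-side of (4.3.1) has ONE term when the matching classes form one conjugacy class** (any transfer factor `T` supported on `R` and a class
function in the second variable — ★ `TransferFactorData` —, any orbital measure family, ANY `f : B → ℂ`): if every `k` with `R a k` is conjugate to `b₀` then
`∑ᶠ c, Δ(a, out c) · Φ(c, f) = Δ(a, b₀) · Φ(⟦b₀⟧, f)` — a class `c ≠ ⟦b₀⟧` has `Δ(a, out c) = 0`, since `Δ(a, out c) ≠ 0` forces `R a (out c)`, hence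
`⟦b₀⟧ = c`. (General-`f` twin of ★ `finsum_delta_mul_classOrbitalIntegral_indicator_eq_of_unique`.) [cite: Rogawski1990, §4.3 (4.3.1)–(4.3.2) p. 43; §4.9 p. 55]
[cite: Kottwitz1986, Cor. 7.3] -/
theorem finsum_delta_mul_classOrbitalIntegral_eq_of_unique
    [∀ b : B, MeasurableSpace (B ⧸ Subgroup.centralizer ({b} : Set B))] {R : A → B → Prop}
    (T : TransferFactorData A B R) (mG : OrbitalMeasureFamily B) (f : B → ℂ) (a : A) (b₀ : B)
    (huniq : ∀ k : B, R a k → IsConj b₀ k) :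
    ∑ᶠ c : ConjClasses B, T.Δ a (Quotient.out c) * classOrbitalIntegral mG f c =
      T.Δ a b₀ * classOrbitalIntegral mG f (ConjClasses.mk b₀) := by
  rw [finsum_eq_single (fun c : ConjClasses B => T.Δ a (Quotient.out c) * classOrbitalIntegral mG f c) (ConjClasses.mk b₀)]
  · -- the value at `⟦b₀⟧`: `out ⟦b₀⟧ = y b₀ y⁻¹`
    obtain ⟨y, hy⟩ := isConj_iff.1 (ConjClasses.mk_eq_mk_iff_isConj.1 (Quotient.out_eq (ConjClasses.mk b₀)).symm)
    rw [← hy, T.conj_right]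
  · intro c hne
    have hΔ : T.Δ a (Quotient.out c) = 0 := by
      refine T.eq_zero_of_not_rel _ _ fun hrel => hne ?_
      have h1 : ConjClasses.mk (Quotient.out c) = ConjClasses.mk b₀ := ConjClasses.mk_eq_mk_iff_isConj.2 (huniq _ hrel).symm
      exact (Quotient.out_eq c).symm.trans h1
    rw [hΔ, zero_mul]

/-- **The `H`-side of (4.3.1) is ONE orbital integral when the stable class is one conjugacy class** (for a «stable conjugacy» `st` containing conjugacy,
any family, ANY `f : A → ℂ`): if every `k` with `st a k` is conjugate to `a` then `Φ^st(a, f) = Φ(⟦a⟧, f)` (★ `stableOrbitalIntegralRel` is the `finsum` over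
the classes `c` with `st a (out c)`, and that set is `{⟦a⟧}`). (General-`f` twin of ★ `stableOrbitalIntegralRel_indicator_eq_classOrbitalIntegral_of_unique`.)
[cite: Rogawski1990, §4.1 (4.1.1) p. 39; §3.5 Prop. 3.5.2 p. 29] -/
theorem stableOrbitalIntegralRel_eq_classOrbitalIntegral_of_unique
    [∀ a : A, MeasurableSpace (A ⧸ Subgroup.centralizer ({a} : Set A))] (st : A → A → Prop)
    (mH : OrbitalMeasureFamily A) (f : A → ℂ) (a : A) (hrefl : ∀ a' : A, IsConj a a' → st a a')
    (huniq : ∀ k : A, st a k → IsConj a k) :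
    stableOrbitalIntegralRel st mH f a = classOrbitalIntegral mH f (ConjClasses.mk a) := by
  rw [stableOrbitalIntegralRel_def]
  have hS : {c : ConjClasses A | st a (Quotient.out c)} = {ConjClasses.mk a} := by
    ext c
    simp only [Set.mem_setOf_eq, Set.mem_singleton_iff]
    constructor
    · intro hc
      exact (Quotient.out_eq c).symm.trans (ConjClasses.mk_eq_mk_iff_isConj.2 (huniq _ hc).symm)
    · rintro rfl
      exact hrefl _ (ConjClasses.mk_eq_mk_iff_isConj.1 (Quotient.out_eq (ConjClasses.mk a)).symm)
  rw [hS, finsum_mem_singleton]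

end Generic

/-! ## §2 The CM Levi stratum: `Φ_H(⟦γ_H⟧, f^H) = Δ_v(γ_H, γ₀) · Φ_G(⟦γ₀⟧, f)` -/

section CM

variable (L : Type) [Field L] [NumberField L] [IsCMField L]

/-- **The frame of the (N-492) stub supplies a norm pair on the Levi stratum (indeed everywhere)**: for `e := cmDatumLocalCongr L v T ha h : U(Φ₃)(L⁺_v) ≃ₜ*
U(H)(L⁺_v)` (`ᵗ(T̄) H_v T = a • Φ₃`) and every `γ_H ∈ H_v`, `ι_v(γ_H) ↔ e(ι_v(γ_H))` (★ `IsLocalNormPair` unfolds to ★ `Corresponds`, and `e g = T g T⁻¹`, ★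
`corresponds_cmDatumLocalCongr`). [cite: Rogawski1990, §14.1 p. 232; §4.3 p. 43] -/
theorem isLocalNormPair_cmDatumLocalCongr_endoEmbLocal (H : Matrix (Fin 3) (Fin 3) L) {v : HeightOneSpectrum (𝓞 ↥(maximalRealSubfield L))}
    (T : GL (Fin 3) (UnitaryGroup.LocalRing L v)) {a : UnitaryGroup.LocalRing L v} (ha : IsUnit a)
    (h : formCongr (conjLocal L (IsCMField.complexConj L) v) T (H.map (algebraMap L (UnitaryGroup.LocalRing L v))) =
      a • (Matrix.of fun i j : Fin 3 => if i.val + j.val + 1 = 3 then (1 : L) else 0).map (algebraMap L (UnitaryGroup.LocalRing L v)))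
    (γH : (cmDatum L 2 (Matrix.of fun i j : Fin 2 => if i.val + j.val + 1 = 2 then (1 : L) else 0)).Local v ×
      (cmDatum L 1 (Matrix.of fun i j : Fin 1 => if i.val + j.val + 1 = 1 then (1 : L) else 0)).Local v) :
    IsLocalNormPair L H v γH (cmDatumLocalCongr L v T ha h (endoEmbLocal L v γH)) :=
  (isLocalNormPair_iff L H v γH _).2 (corresponds_cmDatumLocalCongr L v T ha h (endoEmbLocal L v γH))

/-- **(4.3.1) ON THE LEVI STRATUM HAS ONE TERM ON EACH SIDE — arbitrary test functions, arbitrary families, arbitrary local transfer factor.**  For `H′`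
hermitian with invertible determinant, a finite place `v` of `L⁺`, `γ_H = (g, u) ∈ H_v` with `g = diag(d′₀, d′₁)`, `G`-regular, with `d′₀⁻¹u − 1`, `d′₀⁻¹d′₁ − 1`,
`u − d′₁` units (the LEVI ∕ split-torus stratum: `ι_v(γ_H) = diag(d′₀, u, d′₁)` regular), any norm pair `γ₀` (`ι_v(γ_H) ↔ γ₀`), and any pair `(f^H, f)` satisfying
★ `IsLocalDeltaTransfer L H′ v T mH mG fH f`:
**`classOrbitalIntegral mH fH ⟦γ_H⟧ = T.Δ γ_H γ₀ * classOrbitalIntegral mG f ⟦γ₀⟧`** — the clause of ★ `isLocalDeltaTransfer_iff` at `γ_H`, its left side collapsed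
by ★ `isConj_of_isLocalStablyConjH_of_levi` (the `H`-stable class of `γ_H` is one class), its right side by ★ `isConj_of_isLocalNormPair_of_isLocalNormPair_of_levi`
(all norm pairs of `γ_H` are `G′_v`-conjugate: `𝔇(T∕F) = 1`).  «If `γ ∈ M` … the `κ`-orbital integral is the ordinary orbital integral.»
[cite: Rogawski1990, §4.9 p. 55, Lemma 4.9.2 p. 56; §4.3 (4.3.1) p. 43; §3.5 Prop. 3.5.2 p. 29] [cite: Kottwitz1986, §7] -/
theorem classOrbitalIntegral_eq_delta_mul_classOrbitalIntegral_of_levi (H' : Matrix (Fin 3) (Fin 3) L)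
    (hH' : (H'.map (IsCMField.complexConj L))ᵀ = H') (hH'd : IsUnit H'.det)
    {v : HeightOneSpectrum (𝓞 ↥(maximalRealSubfield L))}
    [∀ γ : ((cmDatum L 3 H').Local v), MeasurableSpace (((cmDatum L 3 H').Local v) ⧸ Subgroup.centralizer ({γ} : Set ((cmDatum L 3 H').Local v)))]
    [∀ a : ((cmDatum L 2 (Matrix.of fun i j : Fin 2 => if i.val + j.val + 1 = 2 then (1 : L) else 0)).Local v ×
      (cmDatum L 1 (Matrix.of fun i j : Fin 1 => if i.val + j.val + 1 = 1 then (1 : L) else 0)).Local v),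
      MeasurableSpace (((cmDatum L 2 (Matrix.of fun i j : Fin 2 => if i.val + j.val + 1 = 2 then (1 : L) else 0)).Local v ×
      (cmDatum L 1 (Matrix.of fun i j : Fin 1 => if i.val + j.val + 1 = 1 then (1 : L) else 0)).Local v) ⧸ Subgroup.centralizer ({a} : Set ((cmDatum L 2 (Matrix.of fun i j : Fin 2 => if i.val + j.val + 1 = 2 then (1 : L) else 0)).Local v ×
      (cmDatum L 1 (Matrix.of fun i j : Fin 1 => if i.val + j.val + 1 = 1 then (1 : L) else 0)).Local v)))]
    (T : LocalTransferFactor L H' v)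
    (mH : OrbitalMeasureFamily ((cmDatum L 2 (Matrix.of fun i j : Fin 2 => if i.val + j.val + 1 = 2 then (1 : L) else 0)).Local v ×
      (cmDatum L 1 (Matrix.of fun i j : Fin 1 => if i.val + j.val + 1 = 1 then (1 : L) else 0)).Local v)) (mG : OrbitalMeasureFamily ((cmDatum L 3 H').Local v))
    {fH : ((cmDatum L 2 (Matrix.of fun i j : Fin 2 => if i.val + j.val + 1 = 2 then (1 : L) else 0)).Local v ×
      (cmDatum L 1 (Matrix.of fun i j : Fin 1 => if i.val + j.val + 1 = 1 then (1 : L) else 0)).Local v) → ℂ}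
    {f : (cmDatum L 3 H').Local v → ℂ} (htr : IsLocalDeltaTransfer L H' v T mH mG fH f)
    {γH : ((cmDatum L 2 (Matrix.of fun i j : Fin 2 => if i.val + j.val + 1 = 2 then (1 : L) else 0)).Local v ×
      (cmDatum L 1 (Matrix.of fun i j : Fin 1 => if i.val + j.val + 1 = 1 then (1 : L) else 0)).Local v)}
    {d' : Fin 2 → (UnitaryGroup.LocalRing L v)ˣ} (hd' : glDiagonal 2 (UnitaryGroup.LocalRing L v) d' = (γH.1.val : GL (Fin 2) (UnitaryGroup.LocalRing L v)))
    (hreg : IsLocalGRegular L v γH)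
    (ha : IsUnit ((((d' 0)⁻¹ * (isUnit_finGammaTwo L v γH).unit : (UnitaryGroup.LocalRing L v)ˣ) : UnitaryGroup.LocalRing L v) - 1))
    (hb : IsUnit ((((d' 0)⁻¹ * d' 1 : (UnitaryGroup.LocalRing L v)ˣ) : UnitaryGroup.LocalRing L v) - 1))
    (h12 : IsUnit (finGammaTwo L v γH - (d' 1 : UnitaryGroup.LocalRing L v)))
    {γ₀ : (cmDatum L 3 H').Local v} (h₀ : IsLocalNormPair L H' v γH γ₀) :
    classOrbitalIntegral mH fH (ConjClasses.mk γH) = T.Δ γH γ₀ * classOrbitalIntegral mG f (ConjClasses.mk γ₀) := by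
  -- the torus datum `ι_v(γ_H) = diag(d′₀, u, d′₁)`, regular
  have hι := endoEmbLocal_eq_glDiagonal_of_fst_eq L v γH hd'
  have hu : (((isUnit_finGammaTwo L v γH).unit : (UnitaryGroup.LocalRing L v)ˣ) : UnitaryGroup.LocalRing L v) = finGammaTwo L v γH :=
    (isUnit_finGammaTwo L v γH).unit_spec
  have hreg3 := isUnit_vecCons_sub_of_levi ha hb (by rw [hu]; exact h12)
  have hHC := isLocalStablyConjH_of_isConj_and_conj L γH
  have h01 : IsUnit ((d' 0 : UnitaryGroup.LocalRing L v) - d' 1) := by simpa using hreg3 0 2 (by decide)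
  -- the clause of (4.3.1) at `γ_H`, both sides collapsed
  have hclause := htr γH hreg
  rw [stableOrbitalIntegralRel_eq_classOrbitalIntegral_of_unique (IsLocalStablyConjH L v) mH fH γH hHC.1
      (fun k hst => isConj_of_isLocalStablyConjH_of_levi L hd' h01 hst),
    finsum_delta_mul_classOrbitalIntegral_eq_of_unique T mG f γH γ₀
      (fun k hk => isConj_of_isLocalNormPair_of_isLocalNormPair_of_levi L H' hH' hH'd γH hι hreg3 h₀ hk)] at hclause
  exact hclause

/-- **The same clause at the frame's norm pair `γ₀ := e(ι_v γ_H)`** of the (N-492) stub (`e := cmDatumLocalCongr L v T ha h`):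
`classOrbitalIntegral mH fH ⟦γ_H⟧ = T.Δ γ_H (e (ι_v γ_H)) * classOrbitalIntegral mG f ⟦e (ι_v γ_H)⟧` — the shape S4 of PLAN v14 §10 substitutes into the `H`-side
torus form, with the `G`-side orbital integral then read by ★ `UnitaryGroupTorusOrbitalIntegralCanonical` (S0 FILE 2) at the same point.
[cite: Rogawski1990, §4.9 Lemma 4.9.2 p. 56; §4.3 (4.3.1) p. 43] -/
theorem classOrbitalIntegral_eq_delta_mul_classOrbitalIntegral_of_levi_cmDatumLocalCongr (H' : Matrix (Fin 3) (Fin 3) L)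
    (hH' : (H'.map (IsCMField.complexConj L))ᵀ = H') (hH'd : IsUnit H'.det)
    {v : HeightOneSpectrum (𝓞 ↥(maximalRealSubfield L))}
    (T₀ : GL (Fin 3) (UnitaryGroup.LocalRing L v)) {a : UnitaryGroup.LocalRing L v} (ha₀ : IsUnit a)
    (h : formCongr (conjLocal L (IsCMField.complexConj L) v) T₀ (H'.map (algebraMap L (UnitaryGroup.LocalRing L v))) =
      a • (Matrix.of fun i j : Fin 3 => if i.val + j.val + 1 = 3 then (1 : L) else 0).map (algebraMap L (UnitaryGroup.LocalRing L v)))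
    [∀ γ : ((cmDatum L 3 H').Local v), MeasurableSpace (((cmDatum L 3 H').Local v) ⧸ Subgroup.centralizer ({γ} : Set ((cmDatum L 3 H').Local v)))]
    [∀ a : ((cmDatum L 2 (Matrix.of fun i j : Fin 2 => if i.val + j.val + 1 = 2 then (1 : L) else 0)).Local v ×
      (cmDatum L 1 (Matrix.of fun i j : Fin 1 => if i.val + j.val + 1 = 1 then (1 : L) else 0)).Local v),
      MeasurableSpace (((cmDatum L 2 (Matrix.of fun i j : Fin 2 => if i.val + j.val + 1 = 2 then (1 : L) else 0)).Local v ×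
      (cmDatum L 1 (Matrix.of fun i j : Fin 1 => if i.val + j.val + 1 = 1 then (1 : L) else 0)).Local v) ⧸ Subgroup.centralizer ({a} : Set ((cmDatum L 2 (Matrix.of fun i j : Fin 2 => if i.val + j.val + 1 = 2 then (1 : L) else 0)).Local v ×
      (cmDatum L 1 (Matrix.of fun i j : Fin 1 => if i.val + j.val + 1 = 1 then (1 : L) else 0)).Local v)))]
    (T : LocalTransferFactor L H' v)
    (mH : OrbitalMeasureFamily ((cmDatum L 2 (Matrix.of fun i j : Fin 2 => if i.val + j.val + 1 = 2 then (1 : L) else 0)).Local v ×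
      (cmDatum L 1 (Matrix.of fun i j : Fin 1 => if i.val + j.val + 1 = 1 then (1 : L) else 0)).Local v)) (mG : OrbitalMeasureFamily ((cmDatum L 3 H').Local v))
    {fH : ((cmDatum L 2 (Matrix.of fun i j : Fin 2 => if i.val + j.val + 1 = 2 then (1 : L) else 0)).Local v ×
      (cmDatum L 1 (Matrix.of fun i j : Fin 1 => if i.val + j.val + 1 = 1 then (1 : L) else 0)).Local v) → ℂ}
    {f : (cmDatum L 3 H').Local v → ℂ} (htr : IsLocalDeltaTransfer L H' v T mH mG fH f)
    {γH : ((cmDatum L 2 (Matrix.of fun i j : Fin 2 => if i.val + j.val + 1 = 2 then (1 : L) else 0)).Local v ×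
      (cmDatum L 1 (Matrix.of fun i j : Fin 1 => if i.val + j.val + 1 = 1 then (1 : L) else 0)).Local v)}
    {d' : Fin 2 → (UnitaryGroup.LocalRing L v)ˣ} (hd' : glDiagonal 2 (UnitaryGroup.LocalRing L v) d' = (γH.1.val : GL (Fin 2) (UnitaryGroup.LocalRing L v)))
    (hreg : IsLocalGRegular L v γH)
    (ha : IsUnit ((((d' 0)⁻¹ * (isUnit_finGammaTwo L v γH).unit : (UnitaryGroup.LocalRing L v)ˣ) : UnitaryGroup.LocalRing L v) - 1))
    (hb : IsUnit ((((d' 0)⁻¹ * d' 1 : (UnitaryGroup.LocalRing L v)ˣ) : UnitaryGroup.LocalRing L v) - 1))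
    (h12 : IsUnit (finGammaTwo L v γH - (d' 1 : UnitaryGroup.LocalRing L v))) :
    classOrbitalIntegral mH fH (ConjClasses.mk γH) =
      T.Δ γH (cmDatumLocalCongr L v T₀ ha₀ h (endoEmbLocal L v γH)) *
        classOrbitalIntegral mG f (ConjClasses.mk (cmDatumLocalCongr L v T₀ ha₀ h (endoEmbLocal L v γH))) :=
  classOrbitalIntegral_eq_delta_mul_classOrbitalIntegral_of_levi L H' hH' hH'd T mH mG htr hd' hreg ha hb h12
    (isLocalNormPair_cmDatumLocalCongr_endoEmbLocal L H' T₀ ha₀ h γH)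

end CM

end Literature.NumberTheory.Rogawski1990

end
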